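import Literature.MathematicalPhysics.QuantumFieldTheory.Balaban1983to89.B9GeoNormsKLevelV1
import Literature.MathematicalPhysics.QuantumFieldTheory.Balaban1983to89.B9Eq335RegularityClasses

/-!
# `Balaban1983to89.B9BackgroundsKLevelV1` — Stage-3′(Y) GEOMETRY∕INDEX layer, MODULE 2: [Balaban1985BackgroundPropagators] p. 396 — the CUBE CLASS of the
# regularity conditions and the BACKGROUND CARRIER `bg9K i : B9.Backgrounds` of a k-level member (the classes (3.35), (3.36), (3.37), (3.38) WITH BODIES on the
# V1 fine torus of the member), plus the `U = 1` facts the N06 knit consumes (`hone`) and the non-degeneracy lemmas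

B9 = T. Bałaban, *Propagators for lattice gauge theories in a background field*, Commun. Math. Phys. **99** (1985) 389–434 [Balaban1985BackgroundPropagators];
held text `paper:balaban1985-cmp99-background-propagators`, p. 396 = p0008 (read by this seat 2026-08-26).  pub-ymgap Track A, node N06; seat `pub-ymgap-dag-n06-a` g3 =
«def-Y», INTERIM DEFINER of the Stage-3′(Y) geometry∕index layer (director-ym LINE №32, rails (i)–(vi): Literature-side carriers, NO stage predicate ∕ `Admissible` ∕
`Record`, genuine data explicit, veto-by-name reserved to re-seated `node00-def` ∕ `def-B` successors).  MODULE 1 of the layer is dag-n03-b's `B9GeoNormsKLevelV1`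
(`geo9K i : B9.Geometry`, p418382).  DEFINITIONS WITH BODIES + kernel-checked API; nothing of [B9]'s estimates is asserted; count-neutral.

WHAT IS PRINTED (p. 396, verbatim up to notation).  «At first let us introduce a class of cubes. For each cube □ of this class there exists a unique index j,
0 ≤ j ≤ k, such that □ ⊂ Bʲ(Λ_j) ∪ B^{j+1}(Λ_{j+1}), □ ∩ Bʲ(Λ_j) ≠ ∅, and □ is a union of several big blocks of the lattice T_{Lʲη}, which implies that its size in
the lattice T_η is O(1)MLʲη. Here O(1) will mean a number ≤ 10. … for an arbitrary cube □ of the described above class, and for a configuration U there exists a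
gauge transformation u on □ such that U^u = e^{iηA}. and if the index of □ is j, then |A| < O(1)Mα₀(Lʲη)⁻¹, |∇^ηA| < O(1)Mα₀(Lʲη)⁻² on □, where O(1)M is a size of □
in T_{L^{−j}} (3.35); |∂^{η*}∂^ηA| < O(1)Mα₀(Lʲη)⁻³ on □ (3.36). … We assume that they have the form U′U, where U has values in G and U′ = e^{iηA′}, A′ ∈ 𝔤ᶜ. …
U satisfies the condition (3.35), and |A′| < α₁(Lʲη)⁻¹, |∇^η_U A′| < α₁(Lʲη)⁻² on Ω_j, j = 0, …, k (3.37); U satisfies (3.35), (3.36), A satisfies (3.37) and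
|D*_UD_UA′| < α₁(Lʲη)⁻³ on Ω_j (3.38).»

WHAT IS DEFINED ∕ PROVED HERE.
* §1 THE CUBE CLASS ON THE TORUS OF RECORD.  For a member `i : B6KLevelCensusIndexV1.KIdx d ℓ hd hL b₀ b₁` (torus `T_η = Site (PV d ℓ i.m i.K hd hL) 0`, domain
  sequence `i.D : TDomains`, big `j`-blocks of side `bigSide ℓ i.Mh j = M·Lʲ` fine units, `M = L·M_h`): `torusCube c s` (the cube of side `s` fine units with lower
  corner `c`, wrap-around by translation), `levV1 i x` (the level `j` of the territory `Bʲ(Λ_j) ∋ x`, p21's level function through the chart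
  `B6GlobalChartV1.toBox`), `IsCube396 i □ j` («a union of several big blocks of T_{Lʲη}» of size `n·M·Lʲ`, `1 ≤ n ≤ 10`, aligned with the big-block grid, a GENUINE
  cube: `n·M·Lʲ <` the torus period), and `cubeClass396 i : Set (Set T_η × ℕ)` (the three printed clauses).  LOCATED READINGS: (a) p21's torus families carry levels
  `1 … k` (`Ω₀ = Ω₁ = T_η`, admitted by [4] p. 224 «some domains Ω_j are equal to T_η»), so print's `j = 0, …, k` is `1 ≤ j ≤ k` here and there is no `Λ₀`-cube;
  (b) the wrap exclusion `n·M·Lʲ < period` only removes «cubes» that do not exist on the finite torus.  Lemmas: `mem_torusCube_self`, `levV1_pos`, `levV1_le`,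
  `cubeClass396_index`, and the ∀-form NON-DEGENERACY `bigBlock_mem_cubeClass396` (every aligned big `j`-block inside `Bʲ(Λ_j)` is a class cube, `n = 1`).
* §2 THE BACKGROUND CARRIER `bg9K 𝔸 G i : B9.Backgrounds` — `Cfg := Fin (d+1) → T_η → 𝔸ˣ` (bond variables `U(x, x+e_μ) = U μ x` with values in the units of a complete
  normed ℂ-algebra `𝔸` ⊇ print's `G ⊂ M_N(ℂ)`; the gauge group `G : Subgroup 𝔸ˣ` and `𝔸` are explicit PARAMETERS — rail (iii)), `one`, `mul U′ U = U′U` pointwise,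
  `Reg335 c α₀ U :=` «U is G-valued» ∧ `B9Eq335RegularityClasses.Reg335` for the torus shifts, the member's `η = (kGeo i).eta`, `L`, the class `cubeClass396 i` and the
  constant `O(1)Mα₀ = c·M·α₀` (`M = (kGeo i).M`); `Reg336` likewise; `Cplx337 α₁ U U′ := ∃ A′, U′ = e^{iηA′} ∧ B9Eq335RegularityClasses.Cplx337 … (levV1 i) α₁ A′`
  (the printed form «U′ = e^{iηA′}»; `A′` ranges over `𝔸`-valued fields as in r06's body, cell divergence D-r1.1); `Cplx338` likewise.  TYPING CHOICE (announced as
  Q-Y1, INBOX [DEFY-G3-DECL-LIST-1]): the G-valuedness conjunct is print's «gauge field configurations U» ∕ «U has values in G»; `G := ⊤` recovers the bare bodies.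
  LOCATED READING (c): print's «O(1)» in (3.35)–(3.36) is the cube's OWN size factor («where O(1)M is a size of □», `n ≤ 10` in `IsCube396`); r06's body and
  r1's `B9.Backgrounds.Reg335 c α₀` carry ONE constant `c` for all cubes (the leaf's `c35`), and so does `bg9K` — for `c ≥ 10` the typed class CONTAINS print's
  (a per-cube constant `n·M·α₀` would be the literal reading; recorded, not adopted, to stay in the tree's vocabulary).
* §3 API and the `U = 1` facts: `reg335_iff` ∕ `cplx337_iff` (unfoldings), `reg336_reg335`, `cplx338_cplx337`, **`reg335Body_one`** ∕ **`reg335_one`** (the configuration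
  `U ≡ 1` is in the class (3.35) for every `c > 0`, `α₀ > 0`: `u = 1`, `A = 0` — the knit's hypothesis `hone` of `B9LeafKnit.b9_main_at_run_of_leaves` at the pin),
  `reg336_one`, `cplx337_one` (`A′ = 0`, r06's `cplx337_zero`), and the ∀-form non-degeneracy `not_reg335_of_not_mem` (a configuration with a value outside `G` is
  NOT in the class).
HONEST SCOPE: carriers and classes only; NO operator (`G′(U)`, `G(U)`, `C⁻¹(U)`, Sect. D∕E) is defined — that layer is unassigned (multi-seat, XL); the Hölder norms
(3.40) with parallel transport are not typed here; one finite lattice programme; NOT continuum ∕ OS ∕ mass gap ∕ Clay.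
-/

noncomputable section

namespace Literature.MathematicalPhysics.QuantumFieldTheory.Balaban1983to89.B9BackgroundsKLevelV1

open B6MultiLevelBoxOperator (bigSide N0)
open B6MultiLevelTorusOperator (TDomains)
open B6KLevelCensusIndexV1 (KIdx kGeo)
open B6GlobalChartV1 (PV toBox)
open B9Eq39Adjoint (fluct)

variable {d ℓ : ℕ} {hd : 1 ≤ d + 1} {hL : Odd (ℓ + 1) ∧ 1 < ℓ + 1} {b₀ b₁ : ℝ}

/-! ## §1 The cube class of p. 396 on the torus of record -/

/-- The cube of side `s` (fine units) with lower corner `c` on the torus `T^{(0)}`: `{x | 0 ≤ x_μ − c_μ < s (mod period) for all μ}` — wrap-around cubes are cubes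
by translation invariance. [cite: Balaban1985BackgroundPropagators, p.396 («a class of cubes»)] -/
def torusCube {P : Params} (c : Site P 0) (s : ℕ) : Set (Site P 0) :=
  {x | ∀ μ, (x μ - c μ).val < s}

/-- the lower corner belongs to its cube (`s ≥ 1`). [cite: Balaban1985BackgroundPropagators, p.396 (bookkeeping)] -/
theorem mem_torusCube_self {P : Params} (c : Site P 0) {s : ℕ} (hs : 0 < s) : c ∈ torusCube c s := by
  intro μ
  simp only [sub_self, ZMod.val_zero]
  exact hs

/-- larger cubes with the same corner contain smaller ones. [cite: Balaban1985BackgroundPropagators, p.396 (bookkeeping)] -/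
theorem torusCube_mono {P : Params} (c : Site P 0) {s s' : ℕ} (h : s ≤ s') : torusCube c s ⊆ torusCube c s' :=
  fun _ hx μ => lt_of_lt_of_le (hx μ) h

/-- The LEVEL of a fine torus site: the index `j` of the territory `Bʲ(Λ_j) = Ω_j∖Ω_{j+1}` containing it, read through the identity chart to p21's fundamental box
(`B6GlobalChartV1.toBox`) on the member's domain sequence `i.D`. [cite: Balaban1985BackgroundPropagators, p.396 («□ ⊂ Bʲ(Λ_j) ∪ B^{j+1}(Λ_{j+1})»); Balaban1984PropagatorsII, (2.3)–(2.4) p.224] -/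
def levV1 (i : KIdx d ℓ hd hL b₀ b₁) (x : Site (PV d ℓ i.m i.K hd hL) 0) : ℕ :=
  i.D.lev (toBox i.hN x).1

/-- every site has level `≥ 1` (p21's reading: `Ω₀ = Ω₁ = T_η`, no `Λ₀`). [cite: Balaban1984PropagatorsII, (2.1) p.224 («some domains Ω_j are equal to T_η»; located reading)] -/
theorem levV1_pos (i : KIdx d ℓ hd hL b₀ b₁) (x : Site (PV d ℓ i.m i.K hd hL) 0) : 1 ≤ levV1 i x :=
  i.D.one_le_lev _

/-- every site has level `≤ k`. [cite: Balaban1984PropagatorsII, (2.1) p.224] -/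
theorem levV1_le (i : KIdx d ℓ hd hL b₀ b₁) (x : Site (PV d ℓ i.m i.K hd hL) 0) : levV1 i x ≤ i.k :=
  i.D.lev_le _

/-- «□ is a union of several big blocks of the lattice T_{Lʲη} … its size in the lattice T_η is O(1)MLʲη. Here O(1) will mean a number ≤ 10»: □ is a torus cube of
side `n · (M·Lʲ)` fine units, `1 ≤ n ≤ 10`, whose corner lies on the big-`j`-block grid, and which is a genuine cube of the finite torus (side `<` period).
[cite: Balaban1985BackgroundPropagators, p.396 (the cube class)] -/
def IsCube396 (i : KIdx d ℓ hd hL b₀ b₁) (cube : Set (Site (PV d ℓ i.m i.K hd hL) 0)) (j : ℕ) : Prop :=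
  ∃ (c : Site (PV d ℓ i.m i.K hd hL) 0) (n : ℕ), 1 ≤ n ∧ n ≤ 10 ∧ (∀ μ, bigSide ℓ i.Mh j ∣ (c μ).val) ∧
    n * bigSide ℓ i.Mh j < (PV d ℓ i.m i.K hd hL).sitesPerDir 0 ∧ cube = torusCube c (n * bigSide ℓ i.Mh j)

/-- **THE CUBE CLASS of p. 396** for the member `i`, as a family of (cube, index) pairs — the parameter `𝒬` of `B9Eq335RegularityClasses.Reg335`: index `1 ≤ j ≤ k`
(located reading (a) of the module docstring), `□` a class cube of index `j` (`IsCube396`), `□ ⊂ Bʲ(Λ_j) ∪ B^{j+1}(Λ_{j+1})`, `□ ∩ Bʲ(Λ_j) ≠ ∅`.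
[cite: Balaban1985BackgroundPropagators, p.396 (the cube class)] -/
def cubeClass396 (i : KIdx d ℓ hd hL b₀ b₁) : Set (Set (Site (PV d ℓ i.m i.K hd hL) 0) × ℕ) :=
  {q | 1 ≤ q.2 ∧ q.2 ≤ i.k ∧ IsCube396 i q.1 q.2 ∧ (∀ x ∈ q.1, levV1 i x = q.2 ∨ levV1 i x = q.2 + 1) ∧ ∃ x ∈ q.1, levV1 i x = q.2}

/-- membership in the cube class, unfolded. [cite: Balaban1985BackgroundPropagators, p.396 (bookkeeping)] -/
theorem mem_cubeClass396_iff (i : KIdx d ℓ hd hL b₀ b₁) (cube : Set (Site (PV d ℓ i.m i.K hd hL) 0)) (j : ℕ) :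
    (cube, j) ∈ cubeClass396 i ↔
      1 ≤ j ∧ j ≤ i.k ∧ IsCube396 i cube j ∧ (∀ x ∈ cube, levV1 i x = j ∨ levV1 i x = j + 1) ∧ ∃ x ∈ cube, levV1 i x = j :=
  Iff.rfl

/-- the index of a class cube lies in `[1, k]`. [cite: Balaban1985BackgroundPropagators, p.396 («a unique index j, 0 ≤ j ≤ k»)] -/
theorem cubeClass396_index {i : KIdx d ℓ hd hL b₀ b₁} {q : Set (Site (PV d ℓ i.m i.K hd hL) 0) × ℕ} (hq : q ∈ cubeClass396 i) :
    1 ≤ q.2 ∧ q.2 ≤ i.k :=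
  ⟨hq.1, hq.2.1⟩

/-- a class cube meets `Bʲ(Λ_j)` for its index `j` (so it is non-empty). [cite: Balaban1985BackgroundPropagators, p.396 («□ ∩ Bʲ(Λ_j) ≠ ∅»)] -/
theorem cubeClass396_nonempty {i : KIdx d ℓ hd hL b₀ b₁} {q : Set (Site (PV d ℓ i.m i.K hd hL) 0) × ℕ} (hq : q ∈ cubeClass396 i) :
    q.1.Nonempty := by
  obtain ⟨x, hx, -⟩ := hq.2.2.2.2
  exact ⟨x, hx⟩

/-- **NON-DEGENERACY of the class (∀-form)**: every big `j`-block — corner on the big-block grid, side `M·Lʲ <` period — all of whose sites lie in `Bʲ(Λ_j)` is a class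
cube of index `j` (`n = 1`), for `1 ≤ j ≤ k`. [cite: Balaban1985BackgroundPropagators, p.396 (the cube class contains the big blocks of Bʲ(Λ_j))] -/
theorem bigBlock_mem_cubeClass396 (i : KIdx d ℓ hd hL b₀ b₁) {j : ℕ} (hj1 : 1 ≤ j) (hjk : j ≤ i.k) (c : Site (PV d ℓ i.m i.K hd hL) 0)
    (hc : ∀ μ, bigSide ℓ i.Mh j ∣ (c μ).val) (hper : bigSide ℓ i.Mh j < (PV d ℓ i.m i.K hd hL).sitesPerDir 0)
    (hlev : ∀ x ∈ torusCube c (bigSide ℓ i.Mh j), levV1 i x = j) :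
    (torusCube c (bigSide ℓ i.Mh j), j) ∈ cubeClass396 i := by
  have hpos : 0 < bigSide ℓ i.Mh j := by
    have h8 : 8 ≤ i.Mh := i.hM8
    unfold bigSide; positivity
  refine ⟨hj1, hjk, ⟨c, 1, le_rfl, by norm_num, hc, by simpa using hper, by simp⟩, fun x hx => Or.inl (hlev x hx), ?_⟩
  exact ⟨c, mem_torusCube_self c hpos, hlev c (mem_torusCube_self c hpos)⟩

/-! ## §2 The background carrier of a member -/

/-- Gauge-field configurations on the fine torus `T^{(0)}` of `P` with values in the units of `𝔸`: `U μ x = U(x, x + e_μ)`.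
[cite: Balaban1985BackgroundPropagators, Sect. A p.390 («U = {U(x, x′)} defined on bonds of T_η»)] -/
abbrev CfgV1 (P : Params) (𝔸 : Type) [Ring 𝔸] : Type := Fin P.d → Site P 0 → 𝔸ˣ

/-- the torus translations `x ↦ x + e_μ` as permutations (pv27's shift datum `T : ι → Equiv.Perm S`). [cite: Balaban1985BackgroundPropagators, (3.3) p.391 (the lattice shifts)] -/
def shiftsV1 (P : Params) : Fin P.d → Equiv.Perm (Site P 0) := fun μ => LatticeFieldCalculus.shiftEquiv μ

section Carrier

variable (𝔸 : Type) [NormedRing 𝔸] [NormedAlgebra ℂ 𝔸] [CompleteSpace 𝔸] (G : Subgroup 𝔸ˣ)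

/-- the body of the (3.35) field: «U is G-valued» ∧ r06's class `Reg335` for the member's torus shifts, `η`, `L`, cube class and the constant `O(1)Mα₀ = c·M·α₀`.
[cite: Balaban1985BackgroundPropagators, (3.35) p.396] -/
def Reg335Body (i : KIdx d ℓ hd hL b₀ b₁) (c α₀ : ℝ) (U : CfgV1 (PV d ℓ i.m i.K hd hL) 𝔸) : Prop :=
  (∀ μ x, U μ x ∈ G) ∧
    B9Eq335RegularityClasses.Reg335 (shiftsV1 _) U (kGeo i).eta (kGeo i).L (cubeClass396 i) (c * (kGeo i).M * α₀)

/-- the body of the (3.36) field. [cite: Balaban1985BackgroundPropagators, (3.35)–(3.36) p.396] -/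
def Reg336Body (i : KIdx d ℓ hd hL b₀ b₁) (c α₀ : ℝ) (U : CfgV1 (PV d ℓ i.m i.K hd hL) 𝔸) : Prop :=
  (∀ μ x, U μ x ∈ G) ∧
    B9Eq335RegularityClasses.Reg336 (shiftsV1 _) U (kGeo i).eta (kGeo i).L (cubeClass396 i) (c * (kGeo i).M * α₀)

/-- the body of the (3.37) field: «U′ = e^{iηA′}» with `A′` in r06's class `Cplx337` on the `Ω_j` of the member (levels `levV1 i`).
[cite: Balaban1985BackgroundPropagators, (3.37) p.396] -/
def Cplx337Body (i : KIdx d ℓ hd hL b₀ b₁) (α₁ : ℝ) (U U' : CfgV1 (PV d ℓ i.m i.K hd hL) 𝔸) : Prop :=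
  ∃ A' : Fin (d + 1) → Site (PV d ℓ i.m i.K hd hL) 0 → 𝔸,
    U' = fluct (kGeo i).eta A' ∧ B9Eq335RegularityClasses.Cplx337 (shiftsV1 _) U (kGeo i).eta (kGeo i).L (levV1 i) α₁ A'

/-- the body of the (3.38) field. [cite: Balaban1985BackgroundPropagators, (3.38) p.396] -/
def Cplx338Body (i : KIdx d ℓ hd hL b₀ b₁) (α₁ : ℝ) (U U' : CfgV1 (PV d ℓ i.m i.K hd hL) 𝔸) : Prop :=
  ∃ A' : Fin (d + 1) → Site (PV d ℓ i.m i.K hd hL) 0 → 𝔸,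
    U' = fluct (kGeo i).eta A' ∧ B9Eq335RegularityClasses.Cplx338 (shiftsV1 _) U (kGeo i).eta (kGeo i).L (levV1 i) α₁ A'

/-- **THE BACKGROUND CARRIER OF A k-LEVEL MEMBER** — the `B9.Backgrounds` datum of Stage 3′(Y) at the member `i`: configurations on the fine torus with values in
`𝔸ˣ`, the trivial configuration, the product `U′U`, and the four printed classes WITH BODIES (`Reg335Body`, `Reg336Body`, `Cplx337Body`, `Cplx338Body`).
`𝔸` and the gauge group `G` are explicit parameters (at the pin: `𝔸 = M_N(ℂ)`, `G = SU(N)`). [cite: Balaban1985BackgroundPropagators, (3.35)–(3.38) p.396] -/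
def bg9K (i : KIdx d ℓ hd hL b₀ b₁) : B9.Backgrounds where
  Cfg := CfgV1 (PV d ℓ i.m i.K hd hL) 𝔸
  one := fun _ _ => 1
  mul := fun U' U μ x => U' μ x * U μ x
  Reg335 := Reg335Body 𝔸 G i
  Reg336 := Reg336Body 𝔸 G i
  Cplx337 := Cplx337Body 𝔸 i
  Cplx338 := Cplx338Body 𝔸 i

/-! ## §3 API, the `U = 1` facts, non-degeneracy -/

variable {𝔸 G}

/-- the configurations of the carrier are the torus gauge fields. [cite: Balaban1985BackgroundPropagators, Sect. A p.390 (bookkeeping)] -/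
theorem bg9K_Cfg (i : KIdx d ℓ hd hL b₀ b₁) : (bg9K 𝔸 G i).Cfg = CfgV1 (PV d ℓ i.m i.K hd hL) 𝔸 := rfl

/-- `(bg9K …).one = 1` bondwise. [cite: Balaban1985BackgroundPropagators, Cor. 3.5 p.407 («U = 1»; bookkeeping)] -/
theorem bg9K_one_apply (i : KIdx d ℓ hd hL b₀ b₁) (μ : Fin (d + 1)) (x : Site (PV d ℓ i.m i.K hd hL) 0) :
    (show CfgV1 (PV d ℓ i.m i.K hd hL) 𝔸 from (bg9K 𝔸 G i).one) μ x = 1 := rfl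

/-- `(bg9K …).mul U′ U = U′U` bondwise. [cite: Balaban1985BackgroundPropagators, p.396 («they have the form U′U»; bookkeeping)] -/
theorem bg9K_mul_apply (i : KIdx d ℓ hd hL b₀ b₁) (U' U : CfgV1 (PV d ℓ i.m i.K hd hL) 𝔸) (μ : Fin (d + 1))
    (x : Site (PV d ℓ i.m i.K hd hL) 0) :
    (show CfgV1 (PV d ℓ i.m i.K hd hL) 𝔸 from (bg9K 𝔸 G i).mul U' U) μ x = U' μ x * U μ x := rfl

/-- `U′ · 1 = U′`. [cite: Balaban1985BackgroundPropagators, Cor. 3.5 p.407 («(3.37) with U = 1»; bookkeeping)] -/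
theorem bg9K_mul_one (i : KIdx d ℓ hd hL b₀ b₁) (U' : CfgV1 (PV d ℓ i.m i.K hd hL) 𝔸) :
    (bg9K 𝔸 G i).mul U' (bg9K 𝔸 G i).one = U' := by
  funext μ x
  exact mul_one _

/-- `1 · U = U`. [cite: Balaban1985BackgroundPropagators, p.396 (bookkeeping)] -/
theorem bg9K_one_mul (i : KIdx d ℓ hd hL b₀ b₁) (U : CfgV1 (PV d ℓ i.m i.K hd hL) 𝔸) :
    (bg9K 𝔸 G i).mul (bg9K 𝔸 G i).one U = U := by
  funext μ x
  exact one_mul _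

/-- the (3.35) field unfolded. [cite: Balaban1985BackgroundPropagators, (3.35) p.396 (bookkeeping)] -/
theorem reg335_iff (i : KIdx d ℓ hd hL b₀ b₁) (c α₀ : ℝ) (U : CfgV1 (PV d ℓ i.m i.K hd hL) 𝔸) :
    (bg9K 𝔸 G i).Reg335 c α₀ U ↔
      (∀ μ x, U μ x ∈ G) ∧
        B9Eq335RegularityClasses.Reg335 (shiftsV1 _) U (kGeo i).eta (kGeo i).L (cubeClass396 i) (c * (kGeo i).M * α₀) :=
  Iff.rfl

/-- the (3.36) field unfolded. [cite: Balaban1985BackgroundPropagators, (3.36) p.396 (bookkeeping)] -/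
theorem reg336_iff (i : KIdx d ℓ hd hL b₀ b₁) (c α₀ : ℝ) (U : CfgV1 (PV d ℓ i.m i.K hd hL) 𝔸) :
    (bg9K 𝔸 G i).Reg336 c α₀ U ↔
      (∀ μ x, U μ x ∈ G) ∧
        B9Eq335RegularityClasses.Reg336 (shiftsV1 _) U (kGeo i).eta (kGeo i).L (cubeClass396 i) (c * (kGeo i).M * α₀) :=
  Iff.rfl

/-- the (3.37) field unfolded. [cite: Balaban1985BackgroundPropagators, (3.37) p.396 (bookkeeping)] -/
theorem cplx337_iff (i : KIdx d ℓ hd hL b₀ b₁) (α₁ : ℝ) (U U' : CfgV1 (PV d ℓ i.m i.K hd hL) 𝔸) :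
    (bg9K 𝔸 G i).Cplx337 α₁ U U' ↔
      ∃ A' : Fin (d + 1) → Site (PV d ℓ i.m i.K hd hL) 0 → 𝔸,
        U' = fluct (kGeo i).eta A' ∧ B9Eq335RegularityClasses.Cplx337 (shiftsV1 _) U (kGeo i).eta (kGeo i).L (levV1 i) α₁ A' :=
  Iff.rfl

/-- the (3.38) field unfolded. [cite: Balaban1985BackgroundPropagators, (3.38) p.396 (bookkeeping)] -/
theorem cplx338_iff (i : KIdx d ℓ hd hL b₀ b₁) (α₁ : ℝ) (U U' : CfgV1 (PV d ℓ i.m i.K hd hL) 𝔸) :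
    (bg9K 𝔸 G i).Cplx338 α₁ U U' ↔
      ∃ A' : Fin (d + 1) → Site (PV d ℓ i.m i.K hd hL) 0 → 𝔸,
        U' = fluct (kGeo i).eta A' ∧ B9Eq335RegularityClasses.Cplx338 (shiftsV1 _) U (kGeo i).eta (kGeo i).L (levV1 i) α₁ A' :=
  Iff.rfl

/-- «later on we will have to assume (3.36) also»: the class (3.35)–(3.36) is contained in the class (3.35) (r06's `Reg336.reg335` fieldwise).
[cite: Balaban1985BackgroundPropagators, p.396 (after (3.36))] -/
theorem reg336_reg335 (i : KIdx d ℓ hd hL b₀ b₁) {c α₀ : ℝ} {U : CfgV1 (PV d ℓ i.m i.K hd hL) 𝔸}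
    (h : (bg9K 𝔸 G i).Reg336 c α₀ U) : (bg9K 𝔸 G i).Reg335 c α₀ U :=
  ⟨h.1, h.2.reg335 _ _⟩

/-- the scale and size parameters of a member are positive: `η = |c_f|⁻¹ > 0`, `L = ℓ + 1 ≥ 1`, `M = L·M_h > 0`.
[cite: Balaban1984PropagatorsII, (2.1) p.224 (bookkeeping on the member's parameters)] -/
theorem eta_pos_L_one_le_M_pos (i : KIdx d ℓ hd hL b₀ b₁) : 0 < (kGeo i).eta ∧ 1 ≤ (kGeo i).L ∧ 0 < (kGeo i).M := by
  refine ⟨?_, ?_, ?_⟩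
  · show 0 < |i.cf|⁻¹
    exact inv_pos.2 (abs_pos.2 i.hcf)
  · show (1 : ℝ) ≤ ((ℓ + 1 : ℕ) : ℝ)
    exact_mod_cast Nat.succ_le_succ (Nat.zero_le ℓ)
  · show 0 < ((ℓ + 1 : ℕ) : ℝ) * (i.Mh : ℝ)
    have h8 : 8 ≤ i.Mh := i.hM8
    positivity

/-- `e^{iη·0} = 1` bondwise: the fluctuation field of `A′ = 0` is the trivial configuration. [cite: Balaban1985BackgroundPropagators, p.396 («U′ = e^{iηA′}»; bookkeeping)] -/
theorem fluct_zero {S : Type*} {ι : Type*} [Fintype ι] [LinearOrder ι] (η : ℝ) :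
    fluct η (0 : ι → S → 𝔸) = fun _ _ => 1 := by
  funext μ x
  ext
  simp [B9Eq39Adjoint.fluct, B9Eq37Insertion.holU, Beta.AdjointTransportJets.val_holUnit,
    Beta.TransportVertices.holPath_cons, Beta.TransportVertices.holPath_nil]

omit [CompleteSpace 𝔸] in
/-- the flat `η`-curl of the zero field vanishes. [cite: Balaban1985BackgroundPropagators, (3.4) p.391 (bookkeeping)] -/
theorem curlη_one_zero {S : Type*} {ι : Type*} (T : ι → Equiv.Perm S) (η : ℝ) :
    B9Eq39Adjoint.curlη T (fun _ _ => (1 : 𝔸ˣ)) η (0 : ι → S → 𝔸) = 0 := by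
  funext μ ν x
  simp [B9Eq39Adjoint.curlη, B9Eq39Adjoint.curl]

omit [CompleteSpace 𝔸] in
/-- the flat `η`-divergence of the zero plaquette function vanishes. [cite: Balaban1985BackgroundPropagators, (3.9) p.392 (bookkeeping)] -/
theorem divPη_one_zero {S : Type*} {ι : Type*} [Fintype ι] [LinearOrder ι] (T : ι → Equiv.Perm S) (η : ℝ) (μ : ι) (x : S) :
    B9Eq39Adjoint.divPη T (fun _ _ => (1 : 𝔸ˣ)) η (0 : ι → ι → S → 𝔸) μ x = 0 := by
  simp [B9Eq39Adjoint.divPη, B9Eq39Adjoint.divP]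

/-- **r06's class (3.35)–(3.36) holds ON ANY CUBE for `U ≡ 1` with any positive constant**: witness `u = 1`, `A = 0` (`U^u = 1 = e^{0}`, all bounds `0 < Cξ⁻ⁿ`).
[cite: Balaban1985BackgroundPropagators, Cor. 3.5 p.407 («for U = 1 these theorems are proved in [4]»: the trivial configuration is regular)] -/
theorem reg336Cube_one [NormOneClass 𝔸] {S : Type*} {ι : Type*} [Fintype ι] [LinearOrder ι] (T : ι → Equiv.Perm S) {η : ℝ}
    (cube : Set S) {ξ C : ℝ} (hξ : 0 < ξ) (hC : 0 < C) :
    B9Eq335RegularityClasses.Reg336Cube T (fun _ _ => (1 : 𝔸ˣ)) η cube ξ C := by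
  refine ⟨fun _ => 1, 0, fun z _ => ⟨by simp, by simp⟩, fun κ z _ => ?_, fun κ z _ => ?_, fun κ ν z _ => ?_, fun μ z _ => ?_⟩
  · rw [fluct_zero]
    simp [B9Eq3117Current.gaugeTr]
  · simp only [Pi.zero_apply, norm_zero]
    exact mul_pos hC (inv_pos.2 hξ)
  · simp only [Pi.zero_apply, B9Eq335RegularityClasses.covD_zero, smul_zero, norm_zero]
    exact mul_pos hC (inv_pos.2 (pow_pos hξ 2))
  · rw [curlη_one_zero, divPη_one_zero, norm_zero]
    exact mul_pos hC (inv_pos.2 (pow_pos hξ 3))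

/-- **`U ≡ 1` IS IN THE CLASS (3.35)–(3.36) OF THE MEMBER** for every `c > 0`, `α₀ > 0` (the knit's hypothesis `hone` at the pin, and its (3.36) twin).
[cite: Balaban1985BackgroundPropagators, Cor. 3.5 p.407 («U = 1»)] -/
theorem reg336_one [NormOneClass 𝔸] (i : KIdx d ℓ hd hL b₀ b₁) {c α₀ : ℝ} (hc : 0 < c) (hα : 0 < α₀) :
    (bg9K 𝔸 G i).Reg336 c α₀ (bg9K 𝔸 G i).one := by
  obtain ⟨hη, hL1, hM⟩ := eta_pos_L_one_le_M_pos i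
  refine ⟨fun _ _ => G.one_mem, fun q _ => ?_⟩
  exact reg336Cube_one (shiftsV1 _) q.1 (B9Eq335RegularityClasses.scaleLen_pos hL1 hη q.2)
    (mul_pos (mul_pos hc hM) hα)

/-- `U ≡ 1` is in the class (3.35) of the member for every `c > 0`, `α₀ > 0` — THE KNIT'S `hone`. [cite: Balaban1985BackgroundPropagators, Cor. 3.5 p.407 («U = 1»)] -/
theorem reg335_one [NormOneClass 𝔸] (i : KIdx d ℓ hd hL b₀ b₁) {c α₀ : ℝ} (hc : 0 < c) (hα : 0 < α₀) :
    (bg9K 𝔸 G i).Reg335 c α₀ (bg9K 𝔸 G i).one :=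
  reg336_reg335 i (reg336_one i hc hα)

/-- **the trivial perturbation `U′ ≡ 1 = e^{iη·0}` is in the class (3.37)** over any background, for every `α₁ > 0` (r06's `cplx337_zero`).
[cite: Balaban1985BackgroundPropagators, (3.37) p.396 (the zero perturbation)] -/
theorem cplx337_one (i : KIdx d ℓ hd hL b₀ b₁) {α₁ : ℝ} (hα : 0 < α₁) (U : CfgV1 (PV d ℓ i.m i.K hd hL) 𝔸) :
    (bg9K 𝔸 G i).Cplx337 α₁ U (bg9K 𝔸 G i).one := by
  obtain ⟨hη, hL1, -⟩ := eta_pos_L_one_le_M_pos i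
  exact ⟨0, (fluct_zero _).symm, B9Eq335RegularityClasses.cplx337_zero (shiftsV1 _) U hL1 hη (levV1 i) hα⟩

/-- **NON-DEGENERACY of the (3.35) field (∀-form)**: a configuration taking a value outside the gauge group `G` is NOT in the class — the class is not all of
`Cfg` as soon as `G ≠ ⊤`. [cite: Balaban1985BackgroundPropagators, p.396 («gauge field configurations U», «U has values in G»)] -/
theorem not_reg335_of_not_mem (i : KIdx d ℓ hd hL b₀ b₁) {c α₀ : ℝ} {U : CfgV1 (PV d ℓ i.m i.K hd hL) 𝔸} {μ : Fin (d + 1)}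
    {x : Site (PV d ℓ i.m i.K hd hL) 0} (hx : U μ x ∉ G) : ¬ (bg9K 𝔸 G i).Reg335 c α₀ U :=
  fun h => hx (h.1 μ x)

/-- a regular configuration is `G`-valued. [cite: Balaban1985BackgroundPropagators, p.396 («U has values in G»)] -/
theorem mem_of_reg335 (i : KIdx d ℓ hd hL b₀ b₁) {c α₀ : ℝ} {U : CfgV1 (PV d ℓ i.m i.K hd hL) 𝔸}
    (h : (bg9K 𝔸 G i).Reg335 c α₀ U) (μ : Fin (d + 1)) (x : Site (PV d ℓ i.m i.K hd hL) 0) : U μ x ∈ G :=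
  h.1 μ x

/-- the per-cube datum of a regular configuration at a class cube, by name (what the Sect. B∕C consumers read: r06's `Reg335Cube` at the scale `Lʲη` of the index).
[cite: Balaban1985BackgroundPropagators, (3.35) p.396] -/
theorem reg335Cube_of_reg335 (i : KIdx d ℓ hd hL b₀ b₁) {c α₀ : ℝ} {U : CfgV1 (PV d ℓ i.m i.K hd hL) 𝔸}
    (h : (bg9K 𝔸 G i).Reg335 c α₀ U) {q : Set (Site (PV d ℓ i.m i.K hd hL) 0) × ℕ} (hq : q ∈ cubeClass396 i) :
    B9Eq335RegularityClasses.Reg335Cube (shiftsV1 _) U (kGeo i).eta q.1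
      (LatticeNorms.scaleLen (kGeo i).L (kGeo i).eta q.2) (c * (kGeo i).M * α₀) :=
  h.2 q hq

end Carrier

/-! ## §4 (v1.1) Recoverability of the bare class at `G = ⊤`, and what the G-valuedness conjunct does NOT constrain

LOCATED (dag-ref-A's rail-(iv) read of the decl list, pub-ymgap INBOX [REFA-G5-DECL-LIST-1-READ], note on Q-Y1): the per-cube gauge transformation `u` and
the generator `A` of r06's body `B9Eq335RegularityClasses.Reg335Cube` (`∃ u A, U^u = e^{iηA} ∧ ‖u‖, ‖u⁻¹‖ ≤ 1 ∧ bounds`) stay UNCONSTRAINED by `bg9K` — print has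
`u` G-valued and `A` 𝔤-valued.  So even with the conjunct «U is G-valued» the typed class (3.35) is the LARGER one; as a leaf HYPOTHESIS on `U` that is the
conservative direction (a leaf at the pin is asked for at least print's backgrounds), while any CONCLUSION-side use (e.g. a gauge-fixing output «U′ ∈ (3.35)»)
reads weaker than print and must say so.  At `G = ⊤` the conjunct is void and the fields are r06's classes verbatim (`reg335_top_iff`, `reg336_top_iff`). -/

section Top

variable {𝔸 : Type} [NormedRing 𝔸] [NormedAlgebra ℂ 𝔸] [CompleteSpace 𝔸]

/-- **RECOVERABILITY**: at the trivial gauge group `G = ⊤` the (3.35) field of `bg9K` IS r06's class `Reg335` at the member's shifts, `η`, `L`, cube class and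
constant. [cite: Balaban1985BackgroundPropagators, (3.35) p.396 (bookkeeping: the bare body at `G = ⊤`)] -/
theorem reg335_top_iff (i : KIdx d ℓ hd hL b₀ b₁) (c α₀ : ℝ) (U : CfgV1 (PV d ℓ i.m i.K hd hL) 𝔸) :
    (bg9K 𝔸 ⊤ i).Reg335 c α₀ U ↔
      B9Eq335RegularityClasses.Reg335 (shiftsV1 _) U (kGeo i).eta (kGeo i).L (cubeClass396 i) (c * (kGeo i).M * α₀) :=
  ⟨fun h => h.2, fun h => ⟨fun _ _ => Subgroup.mem_top _, h⟩⟩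

/-- the same for (3.35)–(3.36). [cite: Balaban1985BackgroundPropagators, (3.35)–(3.36) p.396 (bookkeeping: the bare body at `G = ⊤`)] -/
theorem reg336_top_iff (i : KIdx d ℓ hd hL b₀ b₁) (c α₀ : ℝ) (U : CfgV1 (PV d ℓ i.m i.K hd hL) 𝔸) :
    (bg9K 𝔸 ⊤ i).Reg336 c α₀ U ↔
      B9Eq335RegularityClasses.Reg336 (shiftsV1 _) U (kGeo i).eta (kGeo i).L (cubeClass396 i) (c * (kGeo i).M * α₀) :=
  ⟨fun h => h.2, fun h => ⟨fun _ _ => Subgroup.mem_top _, h⟩⟩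

/-- monotonicity in the gauge group: a smaller `G` gives a smaller class (the conjunct only shrinks the class; the body is `G`-free).
[cite: Balaban1985BackgroundPropagators, p.396 («U has values in G»; bookkeeping)] -/
theorem reg335_mono_group {G G' : Subgroup 𝔸ˣ} (hGG : G ≤ G') (i : KIdx d ℓ hd hL b₀ b₁) {c α₀ : ℝ} {U : CfgV1 (PV d ℓ i.m i.K hd hL) 𝔸}
    (h : (bg9K 𝔸 G i).Reg335 c α₀ U) : (bg9K 𝔸 G' i).Reg335 c α₀ U :=
  ⟨fun μ x => hGG (h.1 μ x), h.2⟩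

end Top

/-! ## §5 (v1.2) COVERAGE: every site of the torus lies in a class cube (dag-ref-A consumer note N-1 on MODULE 2)

With this, the class (3.35) of `bg9K` constrains `U` EVERYWHERE on `T_η` (on p21's tori `Ω₀ = T_η`, so print's «no constraints outside Ω₀» is void here): for every
fine site `x` of level `j`, the big `j`-block of `x` is a class cube of index `j` — aligned by construction, a genuine cube (`M·Lʲ ≤ M·Lᵏ < M·Lᵏ·P′ =` period), its
sites have levels in `{j, j+1}` by [4] (2.1) («Ω_j is a union of big j-blocks», `TDomains.bigBlocks` at levels `j` and `j + 2`), and it meets `Bʲ(Λ_j)` at `x`. -/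

section Coverage

open B4Reflection242 (blk)

/-- block labels of side `s` through the chart: equal iff the `val`-coordinates have equal quotients by `s`. [cite: Balaban1984PropagatorsII, (2.1) p.224 (bookkeeping on block labels)] -/
theorem blk_toBox_eq_iff (i : KIdx d ℓ hd hL b₀ b₁) (s : ℕ) (x y : Site (PV d ℓ i.m i.K hd hL) 0) :
    blk s (toBox i.hN x).1 = blk s (toBox i.hN y).1 ↔ ∀ μ, (x μ).val / s = (y μ).val / s := by
  constructor
  · intro h μ
    have hμ := congrFun h μ
    simp only [blk, B6GlobalChartV1.toBox_apply] at hμ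
    rw [← Int.natCast_div, ← Int.natCast_div] at hμ
    exact_mod_cast hμ
  · intro h
    funext μ
    simp only [blk, B6GlobalChartV1.toBox_apply]
    rw [← Int.natCast_div, ← Int.natCast_div]
    exact_mod_cast h μ

/-- block labels pass to coarser aligned grids: equal `s`-labels ⇒ equal `s·m`-labels. [cite: Balaban1984PropagatorsII, (2.1) p.224 (nested block grids; bookkeeping)] -/
theorem blk_toBox_eq_mul (i : KIdx d ℓ hd hL b₀ b₁) {s m : ℕ} {x y : Site (PV d ℓ i.m i.K hd hL) 0}
    (h : blk s (toBox i.hN x).1 = blk s (toBox i.hN y).1) : blk (s * m) (toBox i.hN x).1 = blk (s * m) (toBox i.hN y).1 := by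
  rw [blk_toBox_eq_iff] at h ⊢
  intro μ
  rw [← Nat.div_div_eq_div_mul, ← Nat.div_div_eq_div_mul, h μ]

/-- **membership in an ALIGNED torus cube whose side divides the period = equality of block labels** (no wrap-around for such cubes).
[cite: Balaban1985BackgroundPropagators, p.396 («a union of several big blocks»; bookkeeping: aligned cubes are label fibres)] -/
theorem mem_torusCube_iff_blk (i : KIdx d ℓ hd hL b₀ b₁) {s : ℕ} (hs : 0 < s) (hsN : s ∣ (PV d ℓ i.m i.K hd hL).sitesPerDir 0)
    (c : Site (PV d ℓ i.m i.K hd hL) 0) (hc : ∀ μ, s ∣ (c μ).val) (x : Site (PV d ℓ i.m i.K hd hL) 0) :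
    x ∈ torusCube c s ↔ blk s (toBox i.hN x).1 = blk s (toBox i.hN c).1 := by
  rw [blk_toBox_eq_iff]
  set N := (PV d ℓ i.m i.K hd hL).sitesPerDir 0 with hNdef
  have key : ∀ μ, ((x μ - c μ).val < s ↔ (x μ).val / s = (c μ).val / s) := by
    intro μ
    obtain ⟨q, hq⟩ := hc μ
    have hcN : (c μ).val < N := ZMod.val_lt _
    have hxN : (x μ).val < N := ZMod.val_lt _
    have hqdiv : (c μ).val / s = q := by rw [hq, Nat.mul_div_cancel_left _ hs]
    rcases le_or_gt (c μ).val (x μ).val with hle | hlt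
    · -- no wrap: `(x − c).val = x.val − c.val`
      rw [ZMod.val_sub hle, hqdiv]
      constructor
      · intro h
        apply Nat.div_eq_of_lt_le
        · rw [mul_comm, ← hq]; exact hle
        · have h' : (x μ).val < (c μ).val + s := by omega
          rw [hq] at h'
          calc (x μ).val < s * q + s := h'
            _ = (q + 1) * s := by ring
      · intro h
        have h2 : (x μ).val < (x μ).val / s * s + s := Nat.lt_div_mul_add hs
        rw [h] at h2
        rw [hq] at hle ⊢
        have e : q * s = s * q := mul_comm _ _
        omega
    · -- wrap: `(x − c).val = N − (c.val − x.val) ≥ N − c.val ≥ s`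
      have hne : c μ - x μ ≠ 0 := by
        intro h0
        have : c μ = x μ := sub_eq_zero.1 h0
        rw [this] at hlt
        exact lt_irrefl _ hlt
      have hval : (x μ - c μ).val = N - ((c μ).val - (x μ).val) := by
        have e : x μ - c μ = -(c μ - x μ) := by ring
        rw [e, ZMod.neg_val, if_neg hne, ZMod.val_sub hlt.le]
      have hsc : (c μ).val + s ≤ N := by
        -- `s ∣ c.val`, `s ∣ N`, `c.val < N` ⇒ `c.val + s ≤ N`
        obtain ⟨t, ht⟩ := hsN
        rw [hq] at hcN ⊢
        rw [ht] at hcN ⊢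
        have : q < t := lt_of_not_ge fun hqt => absurd hcN (not_lt.2 (Nat.mul_le_mul_left s hqt))
        calc s * q + s = s * (q + 1) := by ring
          _ ≤ s * t := Nat.mul_le_mul_left s this
      constructor
      · intro h
        rw [hval] at h
        omega
      · intro h
        exfalso
        -- `x.val / s = q` forces `s·q ≤ x.val`, contradicting `x.val < c.val = s·q`
        have h1 := Nat.div_mul_le_self (x μ).val s
        rw [h, hqdiv] at h1
        rw [hq] at hlt
        rw [mul_comm] at h1
        omega
  exact ⟨fun h μ => (key μ).1 (h μ), fun h μ => (key μ).2 (h μ)⟩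

/-- the big-block grids are nested: `M·Lʲ ∣ M·Lʲ′` for `j ≤ j′`, indeed `M·Lʲ′ = (M·Lʲ)·L^{j′−j}`. [cite: Balaban1984PropagatorsII, (2.1) p.224 (nested block grids; bookkeeping)] -/
theorem bigSide_eq_mul_pow {Mh j j' : ℕ} (hjj : j ≤ j') : bigSide ℓ Mh j' = bigSide ℓ Mh j * (ℓ + 1) ^ (j' - j) := by
  unfold bigSide
  rw [mul_assoc, ← pow_add]
  congr 2
  omega

/-- **COVERAGE: every site of `T_η` lies in a cube of the class (3.35)** — the big `j`-block of a site of level `j` is a class cube of index `j` containing it.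
Hence the typed class constrains a regular `U` on ALL of the torus of record (print: «these regularity conditions do not impose any constraints on U outside
the domain Ω₀»; here `Ω₀ = T_η`). [cite: Balaban1985BackgroundPropagators, p.396 (the cube class covers Ω₀); Balaban1984PropagatorsII, (2.1) p.224 («Ω_j … is a sum of big blocks»)] -/
theorem exists_mem_cubeClass396 (i : KIdx d ℓ hd hL b₀ b₁) (x : Site (PV d ℓ i.m i.K hd hL) 0) : ∃ q ∈ cubeClass396 i, x ∈ q.1 := by
  set j := levV1 i x with hjdef
  set s := bigSide ℓ i.Mh j with hsdef
  have hj1 : 1 ≤ j := levV1_pos i x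
  have hjk : j ≤ i.k := levV1_le i x
  have h8 : 8 ≤ i.Mh := i.hM8
  have hs : 0 < s := by rw [hsdef]; unfold bigSide; positivity
  -- the period is `bigSide k · P′₀`, a multiple of `s`, and exceeds `s`
  have hN : (PV d ℓ i.m i.K hd hL).sitesPerDir 0 = bigSide ℓ i.Mh i.k * i.P' 0 := by
    rw [← i.hN 0, B6MultiLevelTorusOperator.N0_eq_bigSide_mul]
  have hsk : s ∣ bigSide ℓ i.Mh i.k := ⟨(ℓ + 1) ^ (i.k - j), by rw [hsdef]; exact bigSide_eq_mul_pow hjk⟩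
  have hsN : s ∣ (PV d ℓ i.m i.K hd hL).sitesPerDir 0 := by rw [hN]; exact dvd_mul_of_dvd_left hsk _
  have hper : 1 * s < (PV d ℓ i.m i.K hd hL).sitesPerDir 0 := by
    rw [one_mul, hN]
    have h5 : 5 ≤ i.P' 0 := i.hP5 0
    have hsk' : s ≤ bigSide ℓ i.Mh i.k := Nat.le_of_dvd (by unfold bigSide; positivity) hsk
    have hbk : 0 < bigSide ℓ i.Mh i.k := by unfold bigSide; positivity
    calc s ≤ bigSide ℓ i.Mh i.k * 1 := by rw [mul_one]; exact hsk'
      _ < bigSide ℓ i.Mh i.k * i.P' 0 := (Nat.mul_lt_mul_left hbk).2 (by omega)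
  -- the corner of the big `j`-block of `x`
  let c : Site (PV d ℓ i.m i.K hd hL) 0 := fun μ => ((s * ((x μ).val / s) : ℕ) : ZMod _)
  have hcval : ∀ μ, (c μ).val = s * ((x μ).val / s) := by
    intro μ
    show ((((s * ((x μ).val / s) : ℕ)) : ZMod ((PV d ℓ i.m i.K hd hL).sitesPerDir 0))).val = _
    rw [ZMod.val_natCast, Nat.mod_eq_of_lt]
    exact lt_of_le_of_lt (Nat.mul_div_le _ _) (ZMod.val_lt _)
  have hc : ∀ μ, s ∣ (c μ).val := fun μ => ⟨(x μ).val / s, hcval μ⟩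
  have hmem : ∀ y, y ∈ torusCube c s ↔ blk s (toBox i.hN y).1 = blk s (toBox i.hN x).1 := by
    intro y
    rw [mem_torusCube_iff_blk i hs hsN c hc, blk_toBox_eq_iff, blk_toBox_eq_iff]
    refine forall_congr' fun μ => ?_
    rw [hcval, Nat.mul_div_cancel_left _ hs]
  have hx : x ∈ torusCube c s := (hmem x).2 rfl
  -- levels on the block: `j ≤ lev ≤ j + 1` by (2.1) at levels `j` and `j + 2`
  have hlev : ∀ y ∈ torusCube c s, levV1 i y = j ∨ levV1 i y = j + 1 := by
    intro y hy
    have hb := (hmem y).1 hy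
    have hlo : j ≤ levV1 i y := by
      rcases Nat.lt_or_ge j 2 with hj2 | hj2
      · exact le_trans (by omega) (levV1_pos i y)
      · have := i.D.bigBlocks j hj2 (toBox i.hN x).1 (toBox i.hN x).2 (toBox i.hN y).1 (toBox i.hN y).2 hb
        exact this.1 (le_of_eq hjdef)
    have hhi : levV1 i y ≤ j + 1 := by
      rcases Nat.lt_or_ge i.k (j + 2) with hk2 | hk2
      · exact le_trans (levV1_le i y) (by omega)
      · have hb2 : blk (bigSide ℓ i.Mh (j + 2)) (toBox i.hN y).1 = blk (bigSide ℓ i.Mh (j + 2)) (toBox i.hN x).1 := by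
          rw [bigSide_eq_mul_pow (show j ≤ j + 2 by omega)]
          exact blk_toBox_eq_mul i hb
        have := i.D.bigBlocks (j + 2) (by omega) (toBox i.hN x).1 (toBox i.hN x).2 (toBox i.hN y).1 (toBox i.hN y).2 hb2
        have hxj : ¬ (j + 2 ≤ levV1 i x) := by rw [← hjdef]; omega
        have hyj : ¬ (j + 2 ≤ levV1 i y) := fun h => hxj (this.2 h)
        omega
    omega
  exact ⟨(torusCube c s, j), ⟨hj1, hjk, ⟨c, 1, le_rfl, by norm_num, hc, hper, by rw [one_mul]⟩, hlev, ⟨x, hx, hjdef.symm⟩⟩, hx⟩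

/-- **hence the class (3.35) of the member constrains `U` at every site**: a regular `U` carries the per-cube datum on a class cube through any given site.
[cite: Balaban1985BackgroundPropagators, (3.35) p.396 (coverage; bookkeeping)] -/
theorem reg335Cube_through {𝔸 : Type} [NormedRing 𝔸] [NormedAlgebra ℂ 𝔸] [CompleteSpace 𝔸] {G : Subgroup 𝔸ˣ} (i : KIdx d ℓ hd hL b₀ b₁) {c α₀ : ℝ}
    {U : CfgV1 (PV d ℓ i.m i.K hd hL) 𝔸} (h : (bg9K 𝔸 G i).Reg335 c α₀ U) (x : Site (PV d ℓ i.m i.K hd hL) 0) :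
    ∃ q ∈ cubeClass396 i, x ∈ q.1 ∧
      B9Eq335RegularityClasses.Reg335Cube (shiftsV1 _) U (kGeo i).eta q.1 (LatticeNorms.scaleLen (kGeo i).L (kGeo i).eta q.2) (c * (kGeo i).M * α₀) := by
  obtain ⟨q, hq, hx⟩ := exists_mem_cubeClass396 i x
  exact ⟨q, hq, hx, reg335Cube_of_reg335 i h hq⟩

end Coverage

end Literature.MathematicalPhysics.QuantumFieldTheory.Balaban1983to89.B9BackgroundsKLevelV1

end
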